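import Summits.QuantumFields.BalabanUV.Beta.GAN24.DressedLegUnits
import Summits.QuantumFields.BalabanUV.Beta.GAN24.EnvelopeBlockSum

/-!
# `BalabanUV.Beta.GAN24.DressedLegEnvelope` — binder row G-an2-4 / (CONV-C), the row OWNER's CONTACT-TERM ROUTE (`gan24-p1` gen 17,
# `CT-ROUTE-v1.md` §3; INTERFACE REQUEST G-an2-4 (B)), CT-2 IN KERNEL FORM: **THE DRESSED COMPOSITE LEG FAMILIES `T_{m → m+k+1}` ARE
# LOCALISED IN UNITS ON THE SCALE OF THE SOURCE BLOCKS, UNIFORMLY IN THE PAIR OF LEVELS** —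
# `|legChain (respStepBmSeq ρ Lc) m k μ z κ u| ≤ K·(Lc^{4(k+1)})⁻¹·e^{−κ₀‖quo (Lc^(k+1)) u − z‖∞}` (`d = 3`, `Lc ≥ 2`, in-block root)

NOT IN PRINT; OUR BOOKKEEPING (G-an2-4 formalisation swarm, leaf prover `b2b-balaban-gan24-formalise-leaf-01`, gen 57; file C of the CT-2 triple
A `UndressedResponseUnits` → B `DressedLegUnits` (the sup form on bounded data) → C).  HONEST FRAMING (cell contract, verbatim): «discharging `BetaPertH` makes Bałaban's
UV stability UNCONDITIONAL — a real constructive-QFT result; it is NOT the continuum limit and NOT the Clay problem.»  HONEST DEPENDENCY (verbatim):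
«continuum YM on T⁴ ⇐ BetaPertH ∧ nine spine estimates (0/9 proved); BetaPertH ⇐ (D1) ∧ (D4) ∧ CAP+tail; G-an2-4 gates asym, D1 and NE2/3/4.»

WHY A SECOND FILE.  Part 1 bounds the dressed legs ACTING ON BOUNDED DATA (the owner's «`|Ψ| ≤ C·N·σ_f`»); CT-3 (summation by parts) and CT-4i
(influence bound) read the legs as KERNELS — one source bond `(μ, z)` at a time, with their exponential envelope on the scale of the source blocks
(the currency of leaf-12's (N1) and of `Push4Bounds.LegDecay` pushes).  The envelope survives the dressing because every ingredient is BLOCKWISE: a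
level's rooted gauge reads the response inside ONE `Lc`-block, on which the source-scale envelope is CONSTANT (nested labels, `blk_pow_blk_pow`), and a
unit shift of the fine argument costs at most `e^{κ₀}` (leaf-12's `EnvelopeBlockSum.env_wobble`).

## Contents ([folklore]; 0 `def`, 0 `def … : Prop`, 0 cited facts, 0 sorry)
* §1 (generic `d`) BLOCKWISE SUP FORMS: `blk_eq_of_mem_axial` (the letters of the rooted axial contour of `p` live in the block of `p` — the
  step inside leaf-03's `abs_treeGaugeAt_le_blockMass`, isolated), **`abs_treeGaugeAt_le_of_blockwise`** ∕ **`abs_bmGaugeAt_le_of_blockwise`**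
  (`|A κ z| ≤ S (blk N z)` ⟹ `|bmGaugeAt ρ A N p| ≤ 2(d+1)N·S (blk N p)`); `blk_pow_blk_pow` (`blk (Lc^a) ∘ blk (Lc^b) = blk (Lc^(b+a))`, leaf-01's `RespStepBmDecomp.blk_blk`);
  `legAct_single` ∕ `single_eq_delta1` ∕ `legAct_delta1` (a point datum — lit-balaban's `KKTFluctuationKernel.delta1 μ z` — reads the KERNEL ENTRY).
* §2 (`d = 3`, `[NeZero Lc]`, `2 ≤ Lc`; the first two PARAMETRIC in leaf-12's (N1) data `κ₀, C`): **`bmGaugeAt_respStep_envelope`** — the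
  one-level rooted gauge of the undressed composite response COLUMN keeps the column's envelope, read `j+1` levels up:
  `|bmGaugeAt ρ (R_{n,j} μ z) Lc p| ≤ 8·Lc·C·(Lc^{5(j+1)})⁻¹·e^{−κ₀‖blk (Lc^j) (blk Lc p) − z‖∞}`; **`Psi_single_envelope`** — CT-2 IN KERNEL FORM:
  `|Psi ρ Lc m k (single μ z) x| ≤ 16·C·(Lc^{4(k+1)})⁻¹·e^{−κ₀‖quo (Lc^(k+1)) x − z‖∞}` for ALL `m k μ z x` (every level's term carries the SAME
  source-scale envelope; the amplitudes are part 1's geometric series), `Psi_delta1_envelope` (the same at `delta1`); **`exists_legChain_envelope`** — THE DRESSED COMPOSITE LEG FAMILIES LOCALISED IN UNITS: ONE `K ≥ 0` and leaf-12's rate `κ₀ > 0` with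
  `|legChain (respStepBmSeq ρ Lc) m k μ z κ u| ≤ K·(Lc^{4(k+1)})⁻¹·e^{−κ₀‖quo (Lc^(k+1)) u − z‖∞}` for every in-block root and ALL `m k μ z κ u`.
HONEST: `U = 1`, `d = 3`, in-block roots; constants existential (functions of `Lc` and of (N1)'s `κ₀, C`); the rate `κ₀` is leaf-12's, on the scale of
the SOURCE blocks (`Lc^(k+1)` fine units per unit of `‖·‖∞`) — no finer localisation is claimed (the inter-block gauge IS spread over the source
block); zeroth order only; discharges NO binder of (CONV-C), 0 wall binders; NOT CT-3 ∕ CT-4; NEVER «G-an2-4 closed»; NOT D1, NOT BetaPertH, NOT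
continuum, NOT Clay.
-/

noncomputable section

open Finset
open scoped BigOperators
open Literature.MathematicalPhysics.QuantumFieldTheory
open Literature.MathematicalPhysics.QuantumFieldTheory.LatticeForm (quo)
open Literature.MathematicalPhysics.QuantumFieldTheory.Balaban1983to89
open Literature.MathematicalPhysics.QuantumFieldTheory.Balaban1983to89.Beta
open B12Sec2to5 (l1)
open B4ContourShift (supNorm)
open AffineAveraging (Form0 Form1 Site box toSite unitVec dz)
open AveragingContours (blk axial grad_eq_dz blk_block)
open AveragingContoursRooted (treeGaugeAt)
open AxialProjector (zsmul_blk_le lt_zsmul_blk_add blk_eq_of_mem_block)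
open BalabanCompositeJets (respStep)
open Summit.QuantumFields.BalabanUV.Beta.AxialProjectorBlockMean (blockMeanAt bmGaugeAt axProjBmAt)
open Summit.QuantumFields.BalabanUV.Beta.AxialDressingRooted (mem_axial_hull axial_length_le_of_root)
open Summit.QuantumFields.BalabanUV.Beta.GAN24.Push4Iter (LegFam legChain)
open Summit.QuantumFields.BalabanUV.Beta.GAN24.RespStepBmDecompLegs (legAct legAct_apply)
open Summit.QuantumFields.BalabanUV.Beta.GAN24.RespStepBmDecompExact (abs_list_sum_le abs_blockMeanAt_le respStepBmSeq blk_blk_pow)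
open Summit.QuantumFields.BalabanUV.Beta.GAN24.RespStepBmDecompPsi (Psi Psi_apply legAct_legChain_respStepBm)
open Summit.QuantumFields.BalabanUV.Beta.GAN24.RespStepDecay (exists_respStep_decay_and_grad)
open Summit.QuantumFields.BalabanUV.Beta.GAN24.EnvelopeBlockSum (env_wobble)
open Summit.QuantumFields.BalabanUV.Beta.GAN24.UndressedResponseUnits (inv_cast_pow_pow)
open Summit.QuantumFields.BalabanUV.Beta.GAN24.DressedLegUnits (geom_sum_le_of_two_le)

namespace Summit.QuantumFields.BalabanUV.Beta.GAN24.DressedLegEnvelope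

variable {d : ℕ}

/-! ## §1 Blockwise sup forms (generic dimension) -/

/-- [folklore] **THE LETTERS OF THE ROOTED AXIAL CONTOUR OF `p` LIVE IN THE BLOCK OF `p`** (in-block root): every letter of
`axial A (N•blk N p + ρ) p` is `±A κ z′` with `blk N z′ = blk N p` (an2's `mem_axial_hull` — the hull of the root and `p` — and the block
arithmetic `zsmul_blk_le` ∕ `lt_zsmul_blk_add` ∕ `blk_eq_of_mem_block`; the step inside leaf-03's `abs_treeGaugeAt_le_blockMass`, isolated). -/
theorem blk_eq_of_mem_axial {N : ℕ} (hN : 1 ≤ N) {rr : Fin (d + 1) → ℕ} (hrr : rr ∈ box (d + 1) N) {A : Form1 (d + 1) ℝ}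
    {p : Site (d + 1)} {a : ℝ} (ha : a ∈ axial A ((N : ℤ) • blk N p + toSite rr) p) :
    ∃ (κ : Fin (d + 1)) (z' : Site (d + 1)), (a = A κ z' ∨ a = -A κ z') ∧ blk N z' = blk N p := by
  obtain ⟨κ, z', e, hz, -⟩ := mem_axial_hull ha
  refine ⟨κ, z', e, blk_eq_of_mem_block hN (fun i => ?_) (fun i => ?_)⟩
  · have hr0 : (0 : ℤ) ≤ (rr i : ℕ) := by positivity
    have a1 := zsmul_blk_le hN p i
    have eroot : ((N : ℤ) • blk N p + toSite rr) i = ((N : ℤ) • blk N p) i + ((rr i : ℕ) : ℤ) := by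
      simp only [Pi.add_apply, toSite]
    have b := (hz i).1
    have : min (((N : ℤ) • blk N p + toSite rr) i) (p i) ≥ ((N : ℤ) • blk N p) i := le_min (by rw [eroot]; omega) a1
    omega
  · have hri : ((rr i : ℕ) : ℤ) < N := by exact_mod_cast Finset.mem_range.1 (Fintype.mem_piFinset.1 hrr i)
    have a2 := lt_zsmul_blk_add hN p i
    have eroot : ((N : ℤ) • blk N p + toSite rr) i = ((N : ℤ) • blk N p) i + ((rr i : ℕ) : ℤ) := by
      simp only [Pi.add_apply, toSite]
    have b := (hz i).2
    have : max (((N : ℤ) • blk N p + toSite rr) i) (p i) < ((N : ℤ) • blk N p) i + N := max_lt (by rw [eroot]; omega) a2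
    omega

/-- [folklore] **THE ROOTED TREE INTEGRAL, BLOCKWISE SUP FORM**: a blockwise bound `|A κ z| ≤ S (blk N z)` gives
`|λ^ρ_A(p)| ≤ (d+1)·N·S (blk N p)` — all `≤ (d+1)·N` letters sit in the block of `p`. -/
theorem abs_treeGaugeAt_le_of_blockwise {N : ℕ} (hN : 1 ≤ N) {rr : Fin (d + 1) → ℕ} (hrr : rr ∈ box (d + 1) N)
    {A : Form1 (d + 1) ℝ} {S : Site (d + 1) → ℝ} (hA : ∀ κ z, |A κ z| ≤ S (blk N z)) (p : Site (d + 1)) :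
    |treeGaugeAt (toSite rr) A N p| ≤ (((d : ℝ) + 1) * N) * S (blk N p) := by
  unfold treeGaugeAt
  have hS : 0 ≤ S (blk N p) := (abs_nonneg _).trans (hA 0 p)
  have hletter : ∀ a ∈ axial A ((N : ℤ) • blk N p + toSite rr) p, |a| ≤ S (blk N p) := by
    intro a ha
    obtain ⟨κ, z', e, hblk⟩ := blk_eq_of_mem_axial hN hrr ha
    rw [← hblk]
    rcases e with e | e
    · rw [e]; exact hA κ z'
    · rw [e, abs_neg]; exact hA κ z'
  have hlen : ((axial A ((N : ℤ) • blk N p + toSite rr) p).length : ℝ) ≤ ((d : ℝ) + 1) * N := by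
    have h := axial_length_le_of_root hN hrr A p
    exact_mod_cast h
  exact (abs_list_sum_le hletter).trans (mul_le_mul_of_nonneg_right hlen hS)

/-- [folklore] **THE BLOCK-MEAN-NORMALISED ROOTED GAUGE, BLOCKWISE SUP FORM**: `|A κ z| ≤ S (blk N z)` gives
`|bmGaugeAt ρ A N p| ≤ 2·(d+1)·N·S (blk N p)` (the block mean is taken over the same block, `blk_block`). -/
theorem abs_bmGaugeAt_le_of_blockwise {N : ℕ} (hN : 1 ≤ N) {rr : Fin (d + 1) → ℕ} (hrr : rr ∈ box (d + 1) N)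
    {A : Form1 (d + 1) ℝ} {S : Site (d + 1) → ℝ} (hA : ∀ κ z, |A κ z| ≤ S (blk N z)) (p : Site (d + 1)) :
    |bmGaugeAt (toSite rr) A N p| ≤ 2 * ((((d : ℝ) + 1) * N) * S (blk N p)) := by
  unfold bmGaugeAt
  rw [Pi.sub_apply]
  have h1 := abs_treeGaugeAt_le_of_blockwise hN hrr hA p
  have h2 : |blockMeanAt N (treeGaugeAt (toSite rr) A N) p| ≤ (((d : ℝ) + 1) * N) * S (blk N p) :=
    abs_blockMeanAt_le hN _ fun b hb => by
      have h := abs_treeGaugeAt_le_of_blockwise hN hrr hA ((N : ℤ) • blk N p + toSite b)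
      rwa [blk_block (blk N p) hb] at h
  calc |treeGaugeAt (toSite rr) A N p - blockMeanAt N (treeGaugeAt (toSite rr) A N) p|
      ≤ |treeGaugeAt (toSite rr) A N p| + |blockMeanAt N (treeGaugeAt (toSite rr) A N) p| := abs_sub _ _
    _ ≤ _ := by linarith

/-- [folklore] Nested block labels compose: `blk (Lc^a) (blk (Lc^b) x) = blk (Lc^(b+a)) x` (leaf-01's `RespStepBmDecomp.blk_blk` at powers). -/
theorem blk_pow_blk_pow (Lc a b : ℕ) (x : Site (d + 1)) : blk (Lc ^ a) (blk (Lc ^ b) x) = blk (Lc ^ (b + a)) x := by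
  rw [RespStepBmDecomp.blk_blk, ← pow_add]

/-- [folklore] **A POINT DATUM READS THE KERNEL ENTRY**: with `single μ z := fun μ′ y ↦ if μ′ = μ then (if y = z then 1 else 0) else 0`,
`legAct r single κ u = r μ z κ u`. -/
theorem legAct_single (r : LegFam d) (μ : Fin (d + 1)) (z : Site (d + 1)) (κ : Fin (d + 1)) (u : Site (d + 1)) :
    legAct r (fun μ' y => if μ' = μ then (if y = z then (1 : ℝ) else 0) else 0) κ u = r μ z κ u := by
  rw [legAct_apply, Finset.sum_eq_single μ (fun μ' _ hμ' => by simp [hμ']) (fun h => (h (Finset.mem_univ μ)).elim)]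
  simp only [if_true]
  rw [tsum_eq_single z (fun y hy => by simp [hy])]
  simp

/-- [folklore] The point datum is componentwise summable and bounded by `1`. -/
theorem summable_single_and_le (μ : Fin (d + 1)) (z : Site (d + 1)) :
    (∀ μ', Summable (fun y => (fun μ' y => if μ' = μ then (if y = z then (1 : ℝ) else 0) else 0) μ' y)) ∧
      ∀ μ' y, |(fun μ' y => if μ' = μ then (if y = z then (1 : ℝ) else 0) else 0) μ' y| ≤ 1 := by
  refine ⟨fun μ' => ?_, fun μ' y => ?_⟩
  · by_cases h : μ' = μ
    · simp only [h, if_true]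
      exact summable_of_ne_finset_zero (s := {z}) fun y hy => by rw [Finset.mem_singleton] at hy; simp [hy]
    · simp only [h, if_false]; exact summable_zero
  · by_cases h : μ' = μ <;> by_cases h' : y = z <;> simp [h, h']

/-- [folklore] **BRIDGE TO THE CELL's POINT FORCE**: the `if`-datum above IS lit-balaban's `KKTFluctuationKernel.delta1 μ z` (the row owner's
re-cut word, journal l.31094 (i): D1-leaf-05 ∕ leaf-02's CT-1 files speak `delta1`). -/
theorem single_eq_delta1 (μ : Fin (d + 1)) (z : Site (d + 1)) :
    (fun μ' y => if μ' = μ then (if y = z then (1 : ℝ) else 0) else 0) = KKTFluctuationKernel.delta1 μ z := by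
  funext μ' y
  rw [KKTFluctuationKernel.delta1_apply]; by_cases h : μ' = μ <;> by_cases h' : y = z <;> simp [h, h']

/-- [folklore] … hence `legAct r (delta1 μ z) κ u = r μ z κ u`. -/
theorem legAct_delta1 (r : LegFam d) (μ : Fin (d + 1)) (z : Site (d + 1)) (κ : Fin (d + 1)) (u : Site (d + 1)) :
    legAct r (KKTFluctuationKernel.delta1 μ z) κ u = r μ z κ u := by rw [← single_eq_delta1]; exact legAct_single r μ z κ u

/-! ## §2 `d = 3`: the dressed composite legs keep the source-scale envelope -/

section Four

variable {Lc : ℕ} [NeZero Lc]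

/-- NOT IN PRINT; OUR BOOKKEEPING.  **THE ONE-LEVEL ROOTED GAUGE OF THE UNDRESSED COMPOSITE RESPONSE COLUMN KEEPS THE COLUMN's ENVELOPE**
(`d = 3`, in-block root; parametric in leaf-12's (N1) data `κ₀, C`): for the column `R_{n,j} μ z := legAct (respStep (Lc^n) (Lc^(n+j+1))) (single μ z)`
(the gauge's level `n`, source `N = n+j+1`, `j+1` levels up), for ALL `n j μ z p`,
`|bmGaugeAt ρ (R_{n,j} μ z) Lc p| ≤ 8·Lc·C·(Lc^{5(j+1)})⁻¹·e^{−κ₀‖blk (Lc^j) (blk Lc p) − z‖∞}` — the gauge reads the column inside the `Lc`-block of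
`p`, on which the source-scale envelope `e^{−κ₀‖quo (Lc^(j+1)) · − z‖∞}` is CONSTANT (nested labels, `blk_pow_blk_pow`). -/
theorem bmGaugeAt_respStep_envelope {κ₀ C : ℝ}
    (hN1 : ∀ (m k : ℕ) (μ : Fin (3 + 1)) (z : Site (3 + 1)) (l'' : Fin (3 + 1)) (w' : Site (3 + 1)),
      |respStep (d := 3) (Lc ^ m) (Lc ^ (m + k + 1)) μ z l'' w'| ≤
        C * ((Lc : ℝ) ^ (5 * (k + 1)))⁻¹ * Real.exp (-(κ₀ * supNorm (quo (Lc ^ (k + 1)) w' - z))))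
    {rr : Fin (3 + 1) → ℕ} (hrr : rr ∈ box (3 + 1) Lc) (n j N : ℕ) (hN : N = n + j + 1) (μ : Fin (3 + 1)) (z : Site (3 + 1))
    (p : Site (3 + 1)) :
    |bmGaugeAt (toSite rr)
        (legAct (respStep (d := 3) (Lc ^ n) (Lc ^ N)) (fun μ' y => if μ' = μ then (if y = z then (1 : ℝ) else 0) else 0)) Lc p|
      ≤ 8 * (Lc : ℝ) * C * ((Lc : ℝ) ^ (5 * (j + 1)))⁻¹ * Real.exp (-(κ₀ * supNorm (blk (Lc ^ j) (blk Lc p) - z))) := by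
  subst hN
  have hLc : 1 ≤ Lc := Nat.one_le_iff_ne_zero.2 (NeZero.ne Lc)
  -- the column, entrywise, with its envelope written BLOCKWISE in `Lc`-blocks
  have hA : ∀ (κ : Fin (3 + 1)) (w : Site (3 + 1)),
      |legAct (respStep (d := 3) (Lc ^ n) (Lc ^ (n + j + 1))) (fun μ' y => if μ' = μ then (if y = z then (1 : ℝ) else 0) else 0) κ w|
        ≤ (fun q => C * ((Lc : ℝ) ^ (5 * (j + 1)))⁻¹ * Real.exp (-(κ₀ * supNorm (blk (Lc ^ j) q - z)))) (blk Lc w) := by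
    intro κ w
    rw [legAct_single]
    have h := hN1 n j μ z κ w
    have e : quo (Lc ^ (j + 1)) w = blk (Lc ^ j) (blk Lc w) := by
      have h1 : blk (Lc ^ j) (blk (Lc ^ 1) w) = blk (Lc ^ (1 + j)) w := blk_pow_blk_pow Lc j 1 w
      rw [pow_one, Nat.add_comm 1 j] at h1
      rw [h1]
      rfl
    rw [e] at h
    exact h
  have hg := abs_bmGaugeAt_le_of_blockwise (d := 3)
    (S := fun q => C * ((Lc : ℝ) ^ (5 * (j + 1)))⁻¹ * Real.exp (-(κ₀ * supNorm (blk (Lc ^ j) q - z)))) hLc hrr hA p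
  refine hg.trans (le_of_eq ?_)
  push_cast
  ring

/-- NOT IN PRINT; OUR BOOKKEEPING.  **CT-2 IN KERNEL FORM — THE ACCUMULATED INTER-BLOCK GAUGE OF A SOURCE BOND KEEPS THE SOURCE-SCALE ENVELOPE**
(`d = 3`, `2 ≤ Lc`, in-block root; parametric in (N1)'s `κ₀, C` with `C ≥ 0`): for ALL `m k μ z x`,
`|Psi ρ Lc m k (single μ z) x| ≤ 16·C·(Lc^{4(k+1)})⁻¹·e^{−κ₀‖quo (Lc^(k+1)) x − z‖∞}` — every level's term reads its column inside ONE `Lc`-block of the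
label `blk (Lc^(i+1)) x`, where the envelope is the SAME source-scale one (`blk (Lc^(k−i−1)) ∘ blk Lc ∘ blk (Lc^(i+1)) = blk (Lc^(k+1))`); the
amplitudes are part 1's geometric series (ratio `Lc`, the coarsest intermediate level dominates). -/
theorem Psi_single_envelope (hLc : 2 ≤ Lc) {κ₀ C : ℝ} (hC : 0 ≤ C)
    (hN1 : ∀ (m k : ℕ) (μ : Fin (3 + 1)) (z : Site (3 + 1)) (l'' : Fin (3 + 1)) (w' : Site (3 + 1)),
      |respStep (d := 3) (Lc ^ m) (Lc ^ (m + k + 1)) μ z l'' w'| ≤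
        C * ((Lc : ℝ) ^ (5 * (k + 1)))⁻¹ * Real.exp (-(κ₀ * supNorm (quo (Lc ^ (k + 1)) w' - z))))
    {rr : Fin (3 + 1) → ℕ} (hrr : rr ∈ box (3 + 1) Lc) (m k : ℕ) (μ : Fin (3 + 1)) (z : Site (3 + 1)) (x : Site (3 + 1)) :
    |Psi (toSite rr) Lc m k (fun μ' y => if μ' = μ then (if y = z then (1 : ℝ) else 0) else 0) x|
      ≤ 16 * C * ((Lc : ℝ) ^ (4 * (k + 1)))⁻¹ * Real.exp (-(κ₀ * supNorm (quo (Lc ^ (k + 1)) x - z))) := by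
  have hL : (2 : ℝ) ≤ Lc := by exact_mod_cast hLc
  have hL0 : (0 : ℝ) < Lc := by linarith
  set Φ : ℝ := Real.exp (-(κ₀ * supNorm (quo (Lc ^ (k + 1)) x - z))) with hΦ
  have hΦ0 : 0 ≤ Φ := (Real.exp_pos _).le
  rw [Psi_apply, abs_neg]
  -- the `i`-th term: transport factor × (8·Lc·C·(Lc^{5(k−i)})⁻¹) × the SAME envelope `Φ`
  have hterm : ∀ i ∈ Finset.range k,
      |((Lc : ℝ) ^ ((3 + 1) * (i + 1)))⁻¹ *
          bmGaugeAt (toSite rr) (legAct (respStep (d := 3) (Lc ^ (m + i + 1)) (Lc ^ (m + k + 1)))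
            (fun μ' y => if μ' = μ then (if y = z then (1 : ℝ) else 0) else 0)) Lc (blk (Lc ^ (i + 1)) x)|
        ≤ 8 * C * Φ * ((Lc : ℝ) ^ (5 * k + 3))⁻¹ * (Lc : ℝ) ^ i := by
    intro i hi
    have hik : i < k := Finset.mem_range.1 hi
    have hg := bmGaugeAt_respStep_envelope (Lc := Lc) hN1 hrr (m + i + 1) (k - i - 1) (m + k + 1) (by omega) μ z
      (blk (Lc ^ (i + 1)) x)
    -- the envelope's label is the source-scale label of `x`
    have hlab : blk (Lc ^ (k - i - 1)) (blk Lc (blk (Lc ^ (i + 1)) x)) = quo (Lc ^ (k + 1)) x := by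
      rw [blk_blk_pow, blk_pow_blk_pow, show i + 1 + 1 + (k - i - 1) = k + 1 by omega]
      rfl
    rw [hlab, ← hΦ] at hg
    rw [abs_mul, abs_inv, abs_pow, abs_of_pos hL0]
    calc ((Lc : ℝ) ^ ((3 + 1) * (i + 1)))⁻¹ * |bmGaugeAt (toSite rr)
            (legAct (respStep (d := 3) (Lc ^ (m + i + 1)) (Lc ^ (m + k + 1)))
              (fun μ' y => if μ' = μ then (if y = z then (1 : ℝ) else 0) else 0)) Lc (blk (Lc ^ (i + 1)) x)|
        ≤ ((Lc : ℝ) ^ ((3 + 1) * (i + 1)))⁻¹ * (8 * (Lc : ℝ) * C * ((Lc : ℝ) ^ (5 * (k - i - 1 + 1)))⁻¹ * Φ) :=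
          mul_le_mul_of_nonneg_left hg (by positivity)
      _ = 8 * C * Φ * ((Lc : ℝ) ^ (5 * k + 3))⁻¹ * (Lc : ℝ) ^ i := by
          have e : (Lc : ℝ) ^ (5 * k + 3)
              = (Lc : ℝ) ^ ((3 + 1) * (i + 1)) * (Lc : ℝ) ^ (5 * (k - i - 1 + 1)) * (Lc : ℝ) ^ i / Lc := by
            rw [eq_div_iff hL0.ne', ← pow_add, ← pow_add, ← pow_succ]
            congr 1
            omega
          rw [e]
          field_simp
  calc |∑ i ∈ Finset.range k, ((Lc : ℝ) ^ ((3 + 1) * (i + 1)))⁻¹ *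
          bmGaugeAt (toSite rr) (legAct (respStep (d := 3) (Lc ^ (m + i + 1)) (Lc ^ (m + k + 1)))
            (fun μ' y => if μ' = μ then (if y = z then (1 : ℝ) else 0) else 0)) Lc (blk (Lc ^ (i + 1)) x)|
      ≤ ∑ i ∈ Finset.range k, |((Lc : ℝ) ^ ((3 + 1) * (i + 1)))⁻¹ *
          bmGaugeAt (toSite rr) (legAct (respStep (d := 3) (Lc ^ (m + i + 1)) (Lc ^ (m + k + 1)))
            (fun μ' y => if μ' = μ then (if y = z then (1 : ℝ) else 0) else 0)) Lc (blk (Lc ^ (i + 1)) x)| :=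
        Finset.abs_sum_le_sum_abs _ _
    _ ≤ ∑ i ∈ Finset.range k, 8 * C * Φ * ((Lc : ℝ) ^ (5 * k + 3))⁻¹ * (Lc : ℝ) ^ i := Finset.sum_le_sum hterm
    _ = 8 * C * Φ * ((Lc : ℝ) ^ (5 * k + 3))⁻¹ * ∑ i ∈ Finset.range k, (Lc : ℝ) ^ i := by rw [Finset.mul_sum]
    _ ≤ 8 * C * Φ * ((Lc : ℝ) ^ (5 * k + 3))⁻¹ * (2 * (Lc : ℝ) ^ k / Lc) :=
        mul_le_mul_of_nonneg_left (geom_sum_le_of_two_le hL k) (by positivity)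
    _ = 16 * C * ((Lc : ℝ) ^ (4 * (k + 1)))⁻¹ * Φ := by
        have e : (Lc : ℝ) ^ (5 * k + 3) * Lc = (Lc : ℝ) ^ (4 * (k + 1)) * (Lc : ℝ) ^ k := by
          rw [← pow_succ, ← pow_add]
          congr 1
          ring
        field_simp
        linear_combination (-(8 * C * Φ)) * e

/-- NOT IN PRINT; OUR BOOKKEEPING.  **THE SAME AT THE CELL's POINT FORCE `delta1`** (the owner's re-cut word l.31094 (i)):
`|Psi ρ Lc m k (delta1 μ z) x| ≤ 16·C·(Lc^{4(k+1)})⁻¹·e^{−κ₀‖quo (Lc^(k+1)) x − z‖∞}`. -/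
theorem Psi_delta1_envelope (hLc : 2 ≤ Lc) {κ₀ C : ℝ} (hC : 0 ≤ C)
    (hN1 : ∀ (m k : ℕ) (μ : Fin (3 + 1)) (z : Site (3 + 1)) (l'' : Fin (3 + 1)) (w' : Site (3 + 1)),
      |respStep (d := 3) (Lc ^ m) (Lc ^ (m + k + 1)) μ z l'' w'| ≤
        C * ((Lc : ℝ) ^ (5 * (k + 1)))⁻¹ * Real.exp (-(κ₀ * supNorm (quo (Lc ^ (k + 1)) w' - z))))
    {rr : Fin (3 + 1) → ℕ} (hrr : rr ∈ box (3 + 1) Lc) (m k : ℕ) (μ : Fin (3 + 1)) (z : Site (3 + 1)) (x : Site (3 + 1)) :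
    |Psi (toSite rr) Lc m k (KKTFluctuationKernel.delta1 μ z) x|
      ≤ 16 * C * ((Lc : ℝ) ^ (4 * (k + 1)))⁻¹ * Real.exp (-(κ₀ * supNorm (quo (Lc ^ (k + 1)) x - z))) := by
  rw [← single_eq_delta1]; exact Psi_single_envelope hLc hC hN1 hrr m k μ z x

/-- NOT IN PRINT; OUR BOOKKEEPING.  **THE DRESSED COMPOSITE LEG FAMILIES ARE LOCALISED IN UNITS ON THE SCALE OF THE SOURCE BLOCKS, UNIFORMLY IN
THE PAIR OF LEVELS** (`d = 3`, `2 ≤ Lc`, in-block root `ρ = toSite rr`): leaf-12's rate `κ₀ > 0` and ONE `K ≥ 0` with, for ALL `m k`, every source bond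
`(μ, z)` (level `m+k+1`) and every output bond `(κ, u)` (level `m`),
`|legChain (respStepBmSeq ρ Lc) m k μ z κ u| ≤ K·(Lc^{4(k+1)})⁻¹·e^{−κ₀‖quo (Lc^(k+1)) u − z‖∞}` — the kernel entry is the dressed chain acting on the
point datum (`legAct_single`); leaf-03's decomposition splits it into `Π^ρ_bm` of the undressed column (envelope (N1); its rooted gauges at `u` and
`u + e_κ` by `bmGaugeAt_respStep_envelope`, the unit shift costing `e^{κ₀}` by leaf-12's `EnvelopeBlockSum.env_wobble`) plus `dz` of the accumulated
gauge (`Psi_single_envelope` at `u` and `u + e_κ`). -/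
theorem exists_legChain_envelope (hLc : 2 ≤ Lc) :
    ∃ κ₀ K : ℝ, 0 < κ₀ ∧ 0 ≤ K ∧ ∀ (rr : Fin (3 + 1) → ℕ), rr ∈ box (3 + 1) Lc →
      ∀ (m k : ℕ) (μ : Fin (3 + 1)) (z : Site (3 + 1)) (κ : Fin (3 + 1)) (u : Site (3 + 1)),
        |legChain (respStepBmSeq (d := 3) (toSite rr) Lc) m k μ z κ u|
          ≤ K * ((Lc : ℝ) ^ (4 * (k + 1)))⁻¹ * Real.exp (-(κ₀ * supNorm (quo (Lc ^ (k + 1)) u - z))) := by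
  obtain ⟨κ₀, C, C', hκ₀, hC, -, hN1', -⟩ := exists_respStep_decay_and_grad (Lc := Lc)
  have hN1 : ∀ (m k : ℕ) (μ : Fin (3 + 1)) (z : Site (3 + 1)) (l'' : Fin (3 + 1)) (w' : Site (3 + 1)),
      |respStep (d := 3) (Lc ^ m) (Lc ^ (m + k + 1)) μ z l'' w'| ≤
        C * ((Lc : ℝ) ^ (5 * (k + 1)))⁻¹ * Real.exp (-(κ₀ * supNorm (quo (Lc ^ (k + 1)) w' - z))) := by
    intro m k μ z l'' w'
    have h := hN1' m k μ z l'' w'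
    rwa [inv_cast_pow_pow] at h
  set W : ℝ := Real.exp κ₀ + 1 with hW
  have hW0 : 0 ≤ W := by positivity
  refine ⟨κ₀, C + 8 * (Lc : ℝ) * C * W + 16 * C * W, hκ₀, by positivity, ?_⟩
  intro rr hrr m k μ z κ u
  have hLc1 : 1 ≤ Lc := le_trans (by norm_num) hLc
  have hL1 : (1 : ℝ) ≤ Lc := by exact_mod_cast hLc1
  have hLk : 1 ≤ Lc ^ (k + 1) := Nat.one_le_pow _ _ hLc1
  obtain ⟨hsum, -⟩ := summable_single_and_le (d := 3) μ z
  -- abbreviations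
  set L : ℕ := Lc ^ (k + 1) with hLdef
  set Φ : Site (3 + 1) → ℝ := fun w => Real.exp (-(κ₀ * supNorm (quo L w - z))) with hΦ
  have hΦ0 : ∀ w, 0 ≤ Φ w := fun w => (Real.exp_pos _).le
  -- a unit shift of the fine argument costs at most `e^{κ₀}`
  have hshift : ∀ (w : Site (3 + 1)) (ν : Fin (3 + 1)), Φ (w + unitVec ν) ≤ Real.exp κ₀ * Φ w := by
    intro w ν
    have h := env_wobble (d := 3) hLk hκ₀.le z w (w + unitVec ν)
    have hl1 : l1 (w + unitVec ν - w) = 1 := by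
      rw [add_sub_cancel_left]
      unfold l1
      rw [Finset.sum_eq_single ν (fun μ' _ hμ' => by simp [unitVec, hμ'])
        (fun h => (h (Finset.mem_univ ν)).elim)]
      simp [unitVec]
    rw [hl1, mul_one] at h
    exact h
  -- the kernel entry is the chain acting on the point datum; decompose it
  rw [← legAct_single (legChain (respStepBmSeq (d := 3) (toSite rr) Lc) m k) μ z κ u,
    legAct_legChain_respStepBm hrr m k hsum, Pi.add_apply, Pi.add_apply]
  -- (a) the undressed column and its projector
  have hcol : ∀ (κ' : Fin (3 + 1)) (w : Site (3 + 1)),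
      |legAct (respStep (d := 3) (Lc ^ m) (Lc ^ (m + k + 1))) (fun μ' y => if μ' = μ then (if y = z then (1 : ℝ) else 0) else 0) κ' w|
        ≤ C * ((Lc : ℝ) ^ (5 * (k + 1)))⁻¹ * Φ w := by
    intro κ' w
    rw [legAct_single]
    exact hN1 m k μ z κ' w
  have hgauge : ∀ w : Site (3 + 1),
      |bmGaugeAt (toSite rr) (legAct (respStep (d := 3) (Lc ^ m) (Lc ^ (m + k + 1)))
          (fun μ' y => if μ' = μ then (if y = z then (1 : ℝ) else 0) else 0)) Lc w|
        ≤ 8 * (Lc : ℝ) * C * ((Lc : ℝ) ^ (5 * (k + 1)))⁻¹ * Φ w := by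
    intro w
    have h := bmGaugeAt_respStep_envelope (Lc := Lc) hN1 hrr m k (m + k + 1) rfl μ z w
    have hlab : blk (Lc ^ k) (blk Lc w) = quo L w := by
      have h1 := blk_pow_blk_pow Lc k 1 w
      rw [pow_one, show 1 + k = k + 1 by ring] at h1
      rw [h1]; rfl
    rwa [hlab] at h
  have hproj : |axProjBmAt (toSite rr) Lc (legAct (respStep (d := 3) (Lc ^ m) (Lc ^ (m + k + 1)))
        (fun μ' y => if μ' = μ then (if y = z then (1 : ℝ) else 0) else 0)) κ u|
      ≤ (C + 8 * (Lc : ℝ) * C * W) * ((Lc : ℝ) ^ (5 * (k + 1)))⁻¹ * Φ u := by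
    unfold axProjBmAt
    rw [Pi.sub_apply, Pi.sub_apply, grad_eq_dz]
    simp only [dz]
    have h0 := hcol κ u
    have h1 := hgauge (u + unitVec κ)
    have h2 := hgauge u
    have h3 := hshift u κ
    have hE : 0 ≤ 8 * (Lc : ℝ) * C * ((Lc : ℝ) ^ (5 * (k + 1)))⁻¹ := by positivity
    have h1' := h1.trans (mul_le_mul_of_nonneg_left h3 hE)
    calc _ ≤ |legAct (respStep (d := 3) (Lc ^ m) (Lc ^ (m + k + 1)))
              (fun μ' y => if μ' = μ then (if y = z then (1 : ℝ) else 0) else 0) κ u|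
            + |bmGaugeAt (toSite rr) (legAct (respStep (d := 3) (Lc ^ m) (Lc ^ (m + k + 1)))
                (fun μ' y => if μ' = μ then (if y = z then (1 : ℝ) else 0) else 0)) Lc (u + unitVec κ)
              - bmGaugeAt (toSite rr) (legAct (respStep (d := 3) (Lc ^ m) (Lc ^ (m + k + 1)))
                (fun μ' y => if μ' = μ then (if y = z then (1 : ℝ) else 0) else 0)) Lc u| := abs_sub _ _
      _ ≤ C * ((Lc : ℝ) ^ (5 * (k + 1)))⁻¹ * Φ u
            + (8 * (Lc : ℝ) * C * ((Lc : ℝ) ^ (5 * (k + 1)))⁻¹ * (Real.exp κ₀ * Φ u)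
              + 8 * (Lc : ℝ) * C * ((Lc : ℝ) ^ (5 * (k + 1)))⁻¹ * Φ u) :=
          add_le_add h0 ((abs_sub _ _).trans (add_le_add h1' h2))
      _ = _ := by rw [hW]; ring
  -- (b) the accumulated gauge at `u` and `u + e_κ`
  have hPsi : ∀ w : Site (3 + 1),
      |Psi (toSite rr) Lc m k (fun μ' y => if μ' = μ then (if y = z then (1 : ℝ) else 0) else 0) w|
        ≤ 16 * C * ((Lc : ℝ) ^ (4 * (k + 1)))⁻¹ * Φ w :=
    fun w => Psi_single_envelope (Lc := Lc) hLc hC hN1 hrr m k μ z w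
  have hdz : |dz (Psi (toSite rr) Lc m k (fun μ' y => if μ' = μ then (if y = z then (1 : ℝ) else 0) else 0)) κ u|
      ≤ 16 * C * W * ((Lc : ℝ) ^ (4 * (k + 1)))⁻¹ * Φ u := by
    simp only [dz]
    have h1 := hPsi (u + unitVec κ)
    have h2 := hPsi u
    have hE : 0 ≤ 16 * C * ((Lc : ℝ) ^ (4 * (k + 1)))⁻¹ := by positivity
    have h1' := h1.trans (mul_le_mul_of_nonneg_left (hshift u κ) hE)
    refine (abs_sub _ _).trans ((add_le_add h1' h2).trans (le_of_eq ?_))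
    rw [hW]; ring
  -- (c) assemble, trading `(Lc^{5(k+1)})⁻¹ ≤ (Lc^{4(k+1)})⁻¹`
  have hpow : ((Lc : ℝ) ^ (5 * (k + 1)))⁻¹ ≤ ((Lc : ℝ) ^ (4 * (k + 1)))⁻¹ :=
    inv_anti₀ (by positivity) (pow_le_pow_right₀ hL1 (by omega))
  have hc0 : 0 ≤ (C + 8 * (Lc : ℝ) * C * W) * Φ u := mul_nonneg (by positivity) (hΦ0 u)
  have hproj' : |axProjBmAt (toSite rr) Lc (legAct (respStep (d := 3) (Lc ^ m) (Lc ^ (m + k + 1)))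
        (fun μ' y => if μ' = μ then (if y = z then (1 : ℝ) else 0) else 0)) κ u|
      ≤ (C + 8 * (Lc : ℝ) * C * W) * ((Lc : ℝ) ^ (4 * (k + 1)))⁻¹ * Φ u := by
    refine hproj.trans ?_
    have := mul_le_mul_of_nonneg_left hpow hc0
    nlinarith [this]
  exact (abs_add_le _ _).trans ((add_le_add hproj' hdz).trans (le_of_eq (by ring)))

end Four

end Summit.QuantumFields.BalabanUV.Beta.GAN24.DressedLegEnvelope

end
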